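import Summits.ValiantsHypothesis.ValiantsHypothesis.Theorems.IntegralOrbitsTauBurgisserDet

/-!
# Strategist sketch on crux `IntegralOrbits.TauConjecture` (stmt-ValiantsHypothesis-0336)

What the route's deciding theorem ACTUALLY consumes of the Shub–Smale τ-conjecture.

`closes : IntDetQP → TauConjecture → TauBurgisserDet → ValiantsHypothesis`, and the landed proof
`tauBurgisserDet_proof` uses `TauConjecture` only inside `stub_tauEndgame`, i.e. only on the family
`g_n = N · (2^e · f_n)^d`, `f_n = ∏_{k=1}^{n} (X - k)` (Pochhammer–Wilkinson), and only at
QUASI-POLYLOGARITHMIC granularity. We type that slice (`PWPowerMultiplesHardQP`), prove it from the crux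
(one direction of the comparison), and certify an ALTERNATIVE GLUE
`closes_of_pwSlice : IntDetQP → PWPowerMultiplesHardQP → ValiantsHypothesis` from the landed stubs.
Nothing here touches the route file; this is evidence for the tenure planner (route-level re-glue) and for the
strategy census (heading Decomposition).
-/

namespace Summit.ValiantsHypothesis.ValiantsHypothesis.Cruxes.TauConjecture.Strategist

open Polynomial
open Literature.Computability.AlgebraicComplexity
open Summit.ValiantsHypothesis.ValiantsHypothesis.Theses.IntegralOrbits
open Summit.ValiantsHypothesis.ValiantsHypothesis.Theorems
open Summit.ValiantsHypothesis.ValiantsHypothesis.Theorems.IntegralOrbitsTauBurgisserDet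

/-- **The Pochhammer–Wilkinson power slice of the τ-conjecture, quasi-polylog form.** For every `c, n₁` there is
`n ≥ n₁` such that EVERY `N · (2^e · f_n)^d` (`N ≠ 0`, `d ≥ 1`), `f_n = ∏_{k=1}^{n}(X - k)`, has constant-free
complexity `τ > 2^((log₂ log₂ n + c)^c)`. The τ-conjecture gives `τ ≥ n^{1/c₀} - 2`, two exponentials more. -/
def PWPowerMultiplesHardQP : Prop :=
  ∀ c n₁ : ℕ, ∃ n ≥ n₁, ∀ (N : ℤ) (e d : ℕ), N ≠ 0 → 1 ≤ d →
    2 ^ ((Nat.log 2 (Nat.log 2 n) + c) ^ c) <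
      tauPoly (C N * (C ((2 : ℤ) ^ e) * pochhammerWilkinson n) ^ d)

/-- The crux implies the slice (this is `stub_tauEndgame`, contraposed). -/
theorem pwPowerMultiplesHardQP_of_tauConjecture (hτ : TauConjecture) : PWPowerMultiplesHardQP := by
  intro c n₁
  by_contra h
  push_neg at h
  exact stub_tauEndgame hτ ⟨c, n₁, fun n hn => h n hn⟩

/-- **Alternative deciding glue**: the route `IntegralOrbits` closes from `IntDetQP` and the PW-power slice alone
(same Boolean side and transfer as `tauBurgisserDet_proof`; the endgame is replaced by the slice hypothesis). -/
theorem closes_of_pwSlice (h_IntDetQP : IntDetQP) (hH : PWPowerMultiplesHardQP) :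
    _root_.ValiantsHypothesis := by
  intro heq
  have hS := h_IntDetQP heq
  -- Boolean side: `CH ⊆ qpSIZE`
  have hCH := stub_chCollapseQP (stub_perBitsQP stub_tauDetCF hS)
  -- algebraic side at the Pochhammer–Wilkinson coefficients (Cor. 3.9, in tree)
  obtain ⟨c, n₁, hc⟩ := stub_transferQP stub_transferWitness stub_transferCore stub_tauDetCF hS hCH
    (fun n => n) (fun n k => (pochhammerWilkinson n).coeff k)
    Burgisser2009_pochhammerWilkinson_coeff_chDefinable_holds
  obtain ⟨n, hn, hhard⟩ := hH c n₁
  obtain ⟨N, e, d, hN, hd, hb⟩ := hc n hn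
  have hb' : tauPoly (C N * (C ((2 : ℤ) ^ e) * pochhammerWilkinson n) ^ d) ≤
      2 ^ ((Nat.log 2 (Nat.log 2 n) + c) ^ c) := by
    simpa only [sum_range_coeff_pochhammerWilkinson] using hb
  exact absurd hb' (not_le.2 (hhard N e d hN hd))

/-- Sanity: the original three-hypothesis glue factors through the slice. -/
theorem closes_of_tauConjecture' (h_IntDetQP : IntDetQP) (hτ : TauConjecture) : _root_.ValiantsHypothesis :=
  closes_of_pwSlice h_IntDetQP (pwPowerMultiplesHardQP_of_tauConjecture hτ)

end Summit.ValiantsHypothesis.ValiantsHypothesis.Cruxes.TauConjecture.Strategist
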